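import Summits.CriticalPhenomena.PercolationContinuityZ3.Theorems.PercNearOneGluingAdditiveGluingGnegBase
import HarnessLib

/-!
# Crux `PercNearOneGluing.AdditiveGluing` (stmt-CriticalPhenomena-4576), line `subuniform-dead-pocket-maximum`
# — a DECORATED van den Berg–Häggström–Kahn inequality, II: the induction (`gneg_core`)

Helper file for the crux (siege seat k17, stub `stub_goodStep`, variation "C1 kernel first"); lands
with `--supports stmt-CriticalPhenomena-4576`.  No new definitions.  Continues
`PercNearOneGluingAdditiveGluingGnegBase.lean` (pocket locality, base case) and proves the decorated
Theorem 1.1 (GNEG) by BHK's induction on the vertex set (van den Berg–Häggström–Kahn 2006,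
doi:10.1002/rsa.20102, pp. 3–5, as formalised in the tree's `BHK2006.core`):

  `E[F(C_g) q_X(K) 1{g ↮ X}] · P(g ↮ Y) ≤ E[F(C_g) 1{g ↮ X ∩ Y}] · E[q_{X∪Y}(K) 1{g ↮ X ∪ Y}]`

for every decoration `q` of the pocket `K = C(o)` (`q_X(K) = 1` if `K` meets `X`, `= q_∅(K) ∈ [0,1]`
otherwise, `q_∅(K) = 0` if `g ∈ K`).  The one new point of the step is the COVARIANCE OF THE
DECORATION under BHK's conditioning on the layer `S` of `Z = X ∩ Y` (`gneg_q_layer`): with `K'` the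
cluster of `o` in `U ∖ Z`, `K` meets `Z` iff `K'` meets `S`, and otherwise `K = K'`; hence
`q_W(K) = q_{(W∖Z) ∪ S}(K')` for `W ⊇ Z`, the decorated sums condition exactly like BHK's
(`gneg_step_sum` = BHK (6) with the decoration), and the Ahlswede–Daykin hypothesis is again the
weight lattice identity times the induction hypothesis (the join side is an EQUALITY of index sets,
`(X∖Z ∪ S_a) ∪ (Y∖Z ∪ S_b) = (X∪Y)∖Z ∪ S_{a∪b}`, so no monotonicity of `q` in the wrong direction is
needed).  Case `o ∈ X` (`q ≡ 1` on both sides) is `BHK2006.core` with `G ≡ 1`.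
-/

namespace Summit.CriticalPhenomena.PercolationContinuityZ3.Theorems

open Literature.Probability.Percolation Literature.Probability.Percolation.BHK2006 DecisionTree
open scoped Classical

variable {V : Type*}

/-- **Covariance of the decoration under the layer conditioning.**  For `Z ⊆ U`, `o ∉ Z`,
`Z ⊆ W`: `q_W(K_U) = q_{(W ∖ Z) ∪ S}(K_{U∖Z})`, `S = rS U Z ω` the vertices joined to `Z` by an open
edge. [this project] -/
theorem gneg_q_layer {U Z : Finset V} (hZU : Z ⊆ U) {o : V} (ho : o ∉ Z) {W : Set V}
    (hZW : (↑Z : Set V) ⊆ W) (q : Set V → Set V → ℝ)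
    (hqX : ∀ X K, (∃ x ∈ X, x ∈ K) → q X K = 1)
    (hqe : ∀ X K, (∀ x ∈ X, x ∉ K) → q X K = q ∅ K) (ω : Set (Sym2 V)) :
    q W (openCluster (ω ∩ edgesIn U) o) =
      q ((W \ ↑Z) ∪ rS U Z ω) (openCluster (ω ∩ edgesIn (U \ Z)) o) := by
  set K := openCluster (ω ∩ edgesIn U) o with hK
  set K' := openCluster (ω ∩ edgesIn (U \ Z)) o with hK'
  have hK'K : K' ⊆ K := gneg_openCluster_mono_U Finset.sdiff_subset ω o
  by_cases hA : ∃ t ∈ rS U Z ω, t ∈ K'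
  · obtain ⟨t, ht, htK'⟩ := hA
    obtain ⟨htUZ, z, hzZ, htz⟩ := ht
    obtain ⟨htU, htZ⟩ := Finset.mem_sdiff.1 htUZ
    have hzK : z ∈ K := by
      have h1 : (openGraph (ω ∩ edgesIn U)).Reachable o t := hK'K htK'
      exact h1.trans (SimpleGraph.Adj.reachable
        (adj_iff.2 ⟨htz, ⟨htU, hZU hzZ⟩, fun h => htZ (h ▸ hzZ)⟩))
    rw [hqX W K ⟨z, hZW hzZ, hzK⟩, hqX _ K' ⟨t, Or.inr ⟨htUZ, z, hzZ, htz⟩, htK'⟩]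
  · push Not at hA
    have hS : ∀ n ∈ rS U Z ω, ¬ (openGraph (ω ∩ edgesIn (U \ Z))).Reachable o n := hA
    have hKK' : K = K' := by
      refine Set.Subset.antisymm (fun v hv => (reach_restrict ho hS hv).2) hK'K
    by_cases hB : ∃ x ∈ W, x ∈ K
    · obtain ⟨x, hxW, hxK⟩ := hB
      have hxZ : x ∉ (↑Z : Set V) := fun h => (reach_restrict ho hS hxK).1 h
      rw [hqX W K ⟨x, hxW, hxK⟩, hqX _ K' ⟨x, Or.inl ⟨hxW, hxZ⟩, hKK' ▸ hxK⟩]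
    · push Not at hB
      rw [hqe W K hB, hqe _ K', hKK']
      rintro x (⟨hxW, -⟩ | hx)
      · exact fun h => hB x hxW (hK'K h)
      · exact hA x hx

variable [Fintype V]

/-- **BHK's (6) with the decoration**: conditioning the decorated sum
`E[H(C_g^U) q_W(K_U) 1{g ↮ W in U}]` (`Z ⊆ W`) on the layer `S` of `Z`.
[cite: VandenbergHaggstromKahn2005, §1 p. 4, identity (6); decoration: this project] -/
theorem gneg_step_sum {U Z : Finset V} (hZU : Z ⊆ U) {g o : V} (hg : g ∉ Z) (ho : o ∉ Z)
    {W : Set V} (hZW : (↑Z : Set V) ⊆ W) (w : Sym2 V → ℝ) (hm : ∑ ω, weight w ω = 1)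
    (H : Set (Sym2 V) → ℝ) (q : Set V → Set V → ℝ)
    (hqX : ∀ X K, (∃ x ∈ X, x ∈ K) → q X K = 1)
    (hqe : ∀ X K, (∀ x ∈ X, x ∉ K) → q X K = q ∅ K) :
    ∑ ω, weight w ω * (H (rC U g ω) * q W (openCluster (ω ∩ edgesIn U) o) * ind (rD U g W) ω) =
      ∑ ω, weight w ω * ∑ ω', weight w ω' * (H (rC (U \ Z) g ω') *
        q ((W \ ↑Z) ∪ rS U Z ω) (openCluster (ω' ∩ edgesIn (U \ Z)) o) *
          ind (rD (U \ Z) g ((W \ ↑Z) ∪ rS U Z ω)) ω') := by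
  set A := meeting Z with hA
  set Φ : Set (Sym2 V) → Set (Sym2 V) → ℝ := fun ζ η =>
    H (rC (U \ Z) g η) * q ((W \ ↑Z) ∪ rS U Z ζ) (openCluster (η ∩ edgesIn (U \ Z)) o) *
      ind (rD (U \ Z) g ((W \ ↑Z) ∪ rS U Z ζ)) η with hΦ
  have hKdiff : ∀ η : Set (Sym2 V), openCluster ((η \ meeting Z) ∩ edgesIn (U \ Z)) o =
      openCluster (η ∩ edgesIn (U \ Z)) o := fun η => by rw [diff_meeting_inter_edgesIn]
  have h1 : ∀ ω, H (rC U g ω) * q W (openCluster (ω ∩ edgesIn U) o) * ind (rD U g W) ω =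
      Φ (ω ∩ A) (ω \ A) := by
    intro ω
    simp only [hΦ, hA, rS_inter_meeting, rC_diff_meeting, hKdiff]
    rw [← gneg_q_layer hZU ho hZW q hqX hqe ω]
    by_cases hω : ω ∈ rD U g W
    · have hω' := (mem_rD_iff_restrict hZU hg hZW ω).1 hω
      rw [ind_of_mem hω, ind_of_mem ((mem_rD_diff_meeting U Z g _ ω).2 hω'),
        rC_restrict hg fun n hn => hω' n (Or.inr hn)]
    · have hω' : ω \ meeting Z ∉ rD (U \ Z) g ((W \ ↑Z) ∪ rS U Z ω) := fun h =>
        hω ((mem_rD_iff_restrict hZU hg hZW ω).2 ((mem_rD_diff_meeting U Z g _ ω).1 h))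
      rw [ind_of_not_mem hω, ind_of_not_mem hω', mul_zero, mul_zero]
  have h2 : ∀ ω ω', Φ (ω ∩ A) (ω' \ A) = H (rC (U \ Z) g ω') *
      q ((W \ ↑Z) ∪ rS U Z ω) (openCluster (ω' ∩ edgesIn (U \ Z)) o) *
        ind (rD (U \ Z) g ((W \ ↑Z) ∪ rS U Z ω)) ω' := by
    intro ω ω'
    simp only [hΦ, hA, rS_inter_meeting, rC_diff_meeting, hKdiff]
    rw [gneg_ind_congr (mem_rD_diff_meeting U Z g ((W \ ↑Z) ∪ rS U Z ω) ω')]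
  calc ∑ ω, weight w ω * (H (rC U g ω) * q W (openCluster (ω ∩ edgesIn U) o) * ind (rD U g W) ω)
      = (∑ ω, weight w ω) * ∑ ω, weight w ω * Φ (ω ∩ A) (ω \ A) := by
        rw [hm, one_mul]; simp_rw [h1]
    _ = ∑ ω, weight w ω * ∑ ω', weight w ω' * Φ (ω ∩ A) (ω' \ A) := blockFubini w A Φ
    _ = _ := by simp_rw [h2]

/-- **GNEG — the decorated BHK Theorem 1.1** (functional form, percolation restricted to `U`).
For `o, g ∈ U`, `X, Y ⊆ U`, `F ≥ 0` increasing and a decoration `q` (`0 ≤ q ≤ 1`, `q_X(K) = 1` if `K`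
meets `X`, `q_X(K) = q_∅(K)` if not, `q_∅(K) = 0` if `g ∈ K`):
`E[F(C_g) q_X(K) 1{g↮X}] · E[1{g↮Y}] ≤ E[F(C_g) 1{g ↮ X∩Y}] · E[q_{X∪Y}(K) 1{g ↮ X∪Y}]`.
Proof by strong induction on `U` (BHK pp. 3–5 with the decoration riding along).
[this project; `q ≡ 1`: VandenbergHaggstromKahn2005 Thm. 1.1] -/
theorem gneg_core (w : Sym2 V → ℝ) (hw0 : ∀ e, 0 ≤ w e) (hw1 : ∀ e, w e ≤ 1)
    (hm : ∑ ω, weight w ω = 1) (o g : V) (F : Set (Sym2 V) → ℝ) (hF : Monotone F)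
    (hF0 : ∀ a, 0 ≤ F a) (q : Set V → Set V → ℝ) (hq0 : ∀ X K, 0 ≤ q X K) (hq1 : ∀ X K, q X K ≤ 1)
    (hqX : ∀ X K, (∃ x ∈ X, x ∈ K) → q X K = 1)
    (hqe : ∀ X K, (∀ x ∈ X, x ∉ K) → q X K = q ∅ K) (hqg : ∀ K, g ∈ K → q ∅ K = 0)
    (U : Finset V) :
    o ∈ U → g ∈ U → ∀ (X Y : Set V), X ⊆ ↑U → Y ⊆ ↑U →
    (∑ ω, weight w ω * (F (rC U g ω) * q X (openCluster (ω ∩ edgesIn U) o) * ind (rD U g X) ω)) *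
      (∑ ω, weight w ω * ind (rD U g Y) ω) ≤
    (∑ ω, weight w ω * (F (rC U g ω) * ind (rD U g (X ∩ Y)) ω)) *
      (∑ ω, weight w ω * (q (X ∪ Y) (openCluster (ω ∩ edgesIn U) o) * ind (rD U g (X ∪ Y)) ω)) := by
  induction U using Finset.strongInduction with
  | H U ih =>
  intro hoU hgU X Y hXU hYU
  -- monotonicity of the decoration in the index set
  have hqm : ∀ (X Y : Set V) K, q X K ≤ q (X ∪ Y) K := fun X Y K => by
    by_cases h : ∃ x ∈ X, x ∈ K
    · obtain ⟨x, hx, hxK⟩ := h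
      rw [hqX X K ⟨x, hx, hxK⟩, hqX (X ∪ Y) K ⟨x, Or.inl hx, hxK⟩]
    · push Not at h
      rw [hqe X K h]
      by_cases h' : ∃ x ∈ X ∪ Y, x ∈ K
      · rw [hqX _ K h']; exact hq1 _ _
      · push Not at h'
        rw [hqe _ K h']
  -- nonnegativity of the right-hand side
  have hRHS : 0 ≤ (∑ ω, weight w ω * (F (rC U g ω) * ind (rD U g (X ∩ Y)) ω)) *
      (∑ ω, weight w ω * (q (X ∪ Y) (openCluster (ω ∩ edgesIn U) o) * ind (rD U g (X ∪ Y)) ω)) :=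
    mul_nonneg (Finset.sum_nonneg fun ω _ => mul_nonneg (weight_nonneg hw0 hw1 ω)
      (mul_nonneg (hF0 _) (ind_nonneg _ _)))
      (Finset.sum_nonneg fun ω _ => mul_nonneg (weight_nonneg hw0 hw1 ω)
        (mul_nonneg (hq0 _ _) (ind_nonneg _ _)))
  -- trivial cases `g ∈ X`, `g ∈ Y`
  by_cases hgX : g ∈ X
  · have h0 : ∑ ω, weight w ω * (F (rC U g ω) * q X (openCluster (ω ∩ edgesIn U) o) *
        ind (rD U g X) ω) = 0 :=
      Finset.sum_eq_zero fun ω _ => by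
        rw [rD_eq_empty hgX, ind_of_not_mem (Set.notMem_empty ω)]; ring
    rw [h0, zero_mul]; exact hRHS
  by_cases hgY : g ∈ Y
  · have h0 : ∑ ω, weight w ω * ind (rD U g Y) ω = 0 :=
      Finset.sum_eq_zero fun ω _ => by
        rw [rD_eq_empty hgY, ind_of_not_mem (Set.notMem_empty ω)]; ring
    rw [h0, mul_zero]; exact hRHS
  -- the undecorated case `o ∈ X`: BHK Theorem 1.1 with `G ≡ 1`
  by_cases hoX : o ∈ X
  · have hqX1 : ∀ ω : Set (Sym2 V), q X (openCluster (ω ∩ edgesIn U) o) = 1 := fun ω =>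
      hqX X _ ⟨o, hoX, (SimpleGraph.Reachable.refl o : (openGraph (ω ∩ edgesIn U)).Reachable o o)⟩
    have hqXY1 : ∀ ω : Set (Sym2 V), q (X ∪ Y) (openCluster (ω ∩ edgesIn U) o) = 1 := fun ω =>
      hqX (X ∪ Y) _
        ⟨o, Or.inl hoX, (SimpleGraph.Reachable.refl o : (openGraph (ω ∩ edgesIn U)).Reachable o o)⟩
    have key := core w hw0 hw1 hm U g hgU X Y hXU hYU F (fun _ => (1 : ℝ)) hF monotone_const hF0
      (fun _ => zero_le_one)
    simp only [one_mul, mul_one] at key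
    simp_rw [hqX1, hqXY1, mul_one, one_mul]
    exact key
  -- `Z := X ∩ Y`
  set Z : Finset V := U.filter fun v => v ∈ X ∧ v ∈ Y with hZ
  have hZU : Z ⊆ U := Finset.filter_subset _ _
  have hmemZ : ∀ v, v ∈ Z ↔ v ∈ X ∧ v ∈ Y := fun v => by
    simp only [hZ, Finset.mem_filter, and_iff_right_iff_imp]
    exact fun h => hXU h.1
  have hgZ : g ∉ Z := fun h => hgX ((hmemZ g).1 h).1
  have hoZ : o ∉ Z := fun h => hoX ((hmemZ o).1 h).1
  rcases Z.eq_empty_or_nonempty with hZe | hZne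
  · /- `X ∩ Y = ∅`: the base case. -/
    have hXY : ∀ ω, ind (rD U g (X ∩ Y)) ω = 1 := fun ω =>
      ind_of_mem fun x hx _ => by
        have : x ∈ Z := (hmemZ x).2 hx
        rw [hZe] at this
        exact absurd this (Finset.notMem_empty x)
    simp_rw [hXY, mul_one]
    refine gneg_base w hw0 hw1 hm hoU F hF hF0 q (fun K => hq0 X K) (fun K => hqm X Y K) ?_
    intro K hgK hqK
    by_contra h
    push Not at h
    exact hqK ((hqe X K h).trans (hqg K hgK))
  · /- `Z ≠ ∅`: condition on the layer of `Z` and apply the four functions theorem with the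
    induction hypothesis on `U ∖ Z`. -/
    have hss : U \ Z ⊂ U := Finset.sdiff_ssubset hZU hZne
    have hgU' : g ∈ U \ Z := Finset.mem_sdiff.2 ⟨hgU, hgZ⟩
    have hoU' : o ∈ U \ Z := Finset.mem_sdiff.2 ⟨hoU, hoZ⟩
    have hZX : (↑Z : Set V) ⊆ X := fun v hv => ((hmemZ v).1 hv).1
    have hZY : (↑Z : Set V) ⊆ Y := fun v hv => ((hmemZ v).1 hv).2
    have hZXY : (↑Z : Set V) ⊆ X ∩ Y := fun v hv => (hmemZ v).1 hv
    have hZXuY : (↑Z : Set V) ⊆ X ∪ Y := fun v hv => Or.inl (((hmemZ v).1 hv).1)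
    set U' := U \ Z with hU'
    -- the four block sums
    set bE₁ : Set V → ℝ := fun T => ∑ ω', weight w ω' * (F (rC U' g ω') *
      q (X \ ↑Z ∪ T) (openCluster (ω' ∩ edgesIn U') o) * ind (rD U' g (X \ ↑Z ∪ T)) ω') with hbE₁
    set bE₂ : Set V → ℝ := fun T => ∑ ω', weight w ω' * ind (rD U' g (Y \ ↑Z ∪ T)) ω' with hbE₂
    set bE₃ : Set V → ℝ := fun T => ∑ ω', weight w ω' * (F (rC U' g ω') *
      ind (rD U' g ((X ∩ Y) \ ↑Z ∪ T)) ω') with hbE₃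
    set bE₄ : Set V → ℝ := fun T => ∑ ω', weight w ω' *
      (q ((X ∪ Y) \ ↑Z ∪ T) (openCluster (ω' ∩ edgesIn U') o) *
        ind (rD U' g ((X ∪ Y) \ ↑Z ∪ T)) ω') with hbE₄
    have e1 : ∑ ω, weight w ω * (F (rC U g ω) * q X (openCluster (ω ∩ edgesIn U) o) *
        ind (rD U g X) ω) = ∑ ω, weight w ω * bE₁ (rS U Z ω) :=
      gneg_step_sum hZU hgZ hoZ hZX w hm F q hqX hqe
    have e2 : ∑ ω, weight w ω * ind (rD U g Y) ω = ∑ ω, weight w ω * bE₂ (rS U Z ω) := by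
      have := step_sum hZU hgZ hZY w hm (fun _ => (1 : ℝ))
      simpa only [blockE, one_mul] using this
    have e3 : ∑ ω, weight w ω * (F (rC U g ω) * ind (rD U g (X ∩ Y)) ω) =
        ∑ ω, weight w ω * bE₃ (rS U Z ω) := step_sum hZU hgZ hZXY w hm F
    have e4 : ∑ ω, weight w ω * (q (X ∪ Y) (openCluster (ω ∩ edgesIn U) o) *
        ind (rD U g (X ∪ Y)) ω) = ∑ ω, weight w ω * bE₄ (rS U Z ω) := by
      have := gneg_step_sum hZU hgZ hoZ hZXuY w hm (fun _ => (1 : ℝ)) q hqX hqe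
      simpa only [one_mul] using this
    rw [e1, e2, e3, e4]
    -- nonnegativity of the block sums
    have hb1 : ∀ T, 0 ≤ bE₁ T := fun T => Finset.sum_nonneg fun ω _ =>
      mul_nonneg (weight_nonneg hw0 hw1 ω) (mul_nonneg (mul_nonneg (hF0 _) (hq0 _ _)) (ind_nonneg _ _))
    have hb2 : ∀ T, 0 ≤ bE₂ T := fun T => Finset.sum_nonneg fun ω _ =>
      mul_nonneg (weight_nonneg hw0 hw1 ω) (ind_nonneg _ _)
    have hb3 : ∀ T, 0 ≤ bE₃ T := fun T => Finset.sum_nonneg fun ω _ =>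
      mul_nonneg (weight_nonneg hw0 hw1 ω) (mul_nonneg (hF0 _) (ind_nonneg _ _))
    have hb4 : ∀ T, 0 ≤ bE₄ T := fun T => Finset.sum_nonneg fun ω _ =>
      mul_nonneg (weight_nonneg hw0 hw1 ω) (mul_nonneg (hq0 _ _) (ind_nonneg _ _))
    refine four_functions_theorem_univ
      (fun ω => weight w ω * bE₁ (rS U Z ω)) (fun ω => weight w ω * bE₂ (rS U Z ω))
      (fun ω => weight w ω * bE₃ (rS U Z ω)) (fun ω => weight w ω * bE₄ (rS U Z ω))
      (fun ω => mul_nonneg (weight_nonneg hw0 hw1 ω) (hb1 _))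
      (fun ω => mul_nonneg (weight_nonneg hw0 hw1 ω) (hb2 _))
      (fun ω => mul_nonneg (weight_nonneg hw0 hw1 ω) (hb3 _))
      (fun ω => mul_nonneg (weight_nonneg hw0 hw1 ω) (hb4 _))
      fun a b => ?_
    -- the Ahlswede–Daykin hypothesis: weight lattice identity × induction hypothesis
    set Sa := rS U Z a with hSa
    set Sb := rS U Z b with hSb
    have hSaU : Sa ⊆ ↑(U \ Z) := rS_subset U Z a
    have hSbU : Sb ⊆ ↑(U \ Z) := rS_subset U Z b
    have hX1 : X \ ↑Z ∪ Sa ⊆ ↑(U \ Z) := Set.union_subset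
      (fun v hv => by rw [Finset.coe_sdiff]; exact ⟨hXU hv.1, hv.2⟩) hSaU
    have hY1 : Y \ ↑Z ∪ Sb ⊆ ↑(U \ Z) := Set.union_subset
      (fun v hv => by rw [Finset.coe_sdiff]; exact ⟨hYU hv.1, hv.2⟩) hSbU
    have IH := ih (U \ Z) hss hoU' hgU' (X \ ↑Z ∪ Sa) (Y \ ↑Z ∪ Sb) hX1 hY1
    have hsub3 : (X ∩ Y) \ ↑Z ∪ rS U Z (a ∩ b) ⊆ (X \ ↑Z ∪ Sa) ∩ (Y \ ↑Z ∪ Sb) := by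
      refine Set.union_subset (fun v hv => ⟨Or.inl ⟨hv.1.1, hv.2⟩, Or.inl ⟨hv.1.2, hv.2⟩⟩) ?_
      exact fun v hv =>
        ⟨Or.inr (rS_inter_subset U Z a b hv).1, Or.inr (rS_inter_subset U Z a b hv).2⟩
    have heq4 : (X \ ↑Z ∪ Sa) ∪ (Y \ ↑Z ∪ Sb) = (X ∪ Y) \ ↑Z ∪ rS U Z (a ∪ b) := by
      rw [rS_union]
      ext v
      simp only [Set.mem_union, Set.mem_sdiff, hSa, hSb]
      tauto
    have h3 : ∑ ω, weight w ω * (F (rC U' g ω) *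
        ind (rD U' g ((X \ ↑Z ∪ Sa) ∩ (Y \ ↑Z ∪ Sb))) ω) ≤ bE₃ (rS U Z (a ∩ b)) :=
      sum_ind_mono hw0 hw1 (fun _ => hF0 _) (rD_antitone hsub3)
    have h4 : ∑ ω, weight w ω * (q ((X \ ↑Z ∪ Sa) ∪ (Y \ ↑Z ∪ Sb)) (openCluster (ω ∩ edgesIn U') o) *
        ind (rD U' g ((X \ ↑Z ∪ Sa) ∪ (Y \ ↑Z ∪ Sb))) ω) = bE₄ (rS U Z (a ∪ b)) := by
      simp only [hbE₄, heq4]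
    have hIH' : bE₁ Sa * bE₂ Sb ≤ bE₃ (rS U Z (a ∩ b)) * bE₄ (rS U Z (a ∪ b)) :=
      IH.trans (mul_le_mul h3 h4.le (Finset.sum_nonneg fun ω _ =>
        mul_nonneg (weight_nonneg hw0 hw1 ω) (mul_nonneg (hq0 _ _) (ind_nonneg _ _))) (hb3 _))
    have hwab := weight_inter_mul_union w a b
    show weight w a * bE₁ Sa * (weight w b * bE₂ Sb) ≤
      weight w (a ∩ b) * bE₃ (rS U Z (a ∩ b)) * (weight w (a ∪ b) * bE₄ (rS U Z (a ∪ b)))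
    calc weight w a * bE₁ Sa * (weight w b * bE₂ Sb)
        = (weight w a * weight w b) * (bE₁ Sa * bE₂ Sb) := by ring
      _ ≤ (weight w (a ∩ b) * weight w (a ∪ b)) *
          (bE₃ (rS U Z (a ∩ b)) * bE₄ (rS U Z (a ∪ b))) := by
          rw [hwab]
          exact mul_le_mul_of_nonneg_left hIH'
            (mul_nonneg (weight_nonneg hw0 hw1 _) (weight_nonneg hw0 hw1 _))
      _ = _ := by ring

/-- **Registered sub-goal `stub_gnegCore_k17`** (siege k17): the decorated BHK inequality GNEG,
closed form of `gneg_core` (vertex type in `Type`). [this project] -/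
theorem stub_gnegCore_k17 : ∀ (V : Type) [Fintype V] (w : Sym2 V → ℝ), (∀ e, 0 ≤ w e) → (∀ e, w e ≤ 1) → (∑ ω, weight w ω = 1) → ∀ (o g : V) (F : Set (Sym2 V) → ℝ), Monotone F → (∀ a, 0 ≤ F a) → ∀ (q : Set V → Set V → ℝ), (∀ X K, 0 ≤ q X K) → (∀ X K, q X K ≤ 1) → (∀ X K, (∃ x ∈ X, x ∈ K) → q X K = 1) → (∀ X K, (∀ x ∈ X, x ∉ K) → q X K = q ∅ K) → (∀ K, g ∈ K → q ∅ K = 0) → ∀ (U : Finset V), o ∈ U → g ∈ U → ∀ (X Y : Set V), X ⊆ ↑U → Y ⊆ ↑U → (∑ ω, weight w ω * (F (rC U g ω) * q X (openCluster (ω ∩ edgesIn U) o) * ind (rD U g X) ω)) * (∑ ω, weight w ω * ind (rD U g Y) ω) ≤ (∑ ω, weight w ω * (F (rC U g ω) * ind (rD U g (X ∩ Y)) ω)) * (∑ ω, weight w ω * (q (X ∪ Y) (openCluster (ω ∩ edgesIn U) o) * ind (rD U g (X ∪ Y)) ω)) :=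
  fun _ _ w hw0 hw1 hm o g F hF hF0 q hq0 hq1 hqX hqe hqg U hoU hgU X Y hXU hYU =>
    gneg_core w hw0 hw1 hm o g F hF hF0 q hq0 hq1 hqX hqe hqg U hoU hgU X Y hXU hYU

end Summit.CriticalPhenomena.PercolationContinuityZ3.Theorems
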